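import Summits.BirchSwinnertonDyer.Rank1Residual.X12.CMIrreducible
import Literature.NumberTheory.EllipticCurves.ThreeIsogeny
import Literature.NumberTheory.EllipticCurves.Rank1Residual.GVParityLineTypeProofs
import Literature.NumberTheory.EllipticCurves.Rank1Residual.GVParityTwistProofs
import Literature.NumberTheory.EllipticCurves.QuadraticTwistJInvariantProofs
import HarnessLib

/-!
# Every elliptic curve over `ℚ` with `j = 0` has REDUCIBLE `E[3]` — the ramified complement of the
# CM irreducibility theorem on the `j = 0` family (kernel no-go for irreducible-image levers there)

HONEST FRAMING (cell `b2b-bsdres`, run/shared/lean/b2b/bsd-rank1-residual/, verbatim in every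
file): the goal of the cell is to DELETE the COMBINATION-SHAPED residual classes of the
Birch–Swinnerton-Dyer formula for ALL analytic-rank `≤ 1` elliptic curves over `ℚ` — "full BSD
formula for every rank `≤ 1` curve in class `C`" assembled STRICTLY from published theorems — so
that the rank-`≤ 1` remainder becomes exactly the CONSTRUCTION-SHAPED classes, which are TYPED
(missing-input `Prop`s), NOT attempted. This is not "finishing BSD". Harvest seat 1 (census owner
of class X12), generation 15. Theorems only (no definition, no named fact, no axiom); X12 REMAINS
CONSTRUCTION-SHAPED; nothing is booked; no label and no census number moves.

## Why this file

`CMIrreducible.lean` (p205402) proves `irr(p)` for every CM curve over `ℚ` at every odd prime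
`p ∤ d_K`, and the docstrings assert that `p ∣ d_K` cannot be dropped. On the cell's census
(hyp `hyp_core.tsv`, 238 X12 pairs) the ramified X12 pairs are 113, of which **98 are `j = 0`
curves at `p = 3`** (`d_K = −3`). This file proves the no-go for those 98 and for every other
`j = 0` curve: **`j(E) = 0 ⟹ E[3]` is a REDUCIBLE `𝔽₃[G_ℚ]`-module** (`red_three_of_j_eq_zero`),
so that no irreducible-image lever (T-MN19, T-KOLY, Cha, …) can ever apply to them — they are the
domain of the reducible / congruence routes (Kriz–Li 2019 at `p = 3`, the cube-sum transports of
harvest-1 gens 3–6). With `irr_of_j_eq_zero` (gen 14, `p ≥ 5`) this gives the exact DICHOTOMY on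
the `j = 0` family at odd `p`: `irr(p) ⟺ p ≠ 3 ⟺ ¬ CMRamified` (`irr_iff_ne_three_of_j_eq_zero`,
`irr_iff_not_cmRamified_of_j_eq_zero`).

## Proof (compositions of tree theorems BY NAME)

A `j = 0` curve `W` is `ℚ`-isomorphic to a short model `S : y² = x³ + B` (Mathlib
`exists_variableChange_isShortNF`; `j = 6912a₄³/(4a₄³ + 27a₆²) = 0` forces `a₄ = 0`). Its
quadratic twist by `B` is `y² = x³ + B⁴ = threeTorsionModel 0 B²` of the tree's `ThreeIsogeny`
(`y² = x³ + (mx + s)²`), which carries the RATIONAL point `T = (0, B²)` of order `3`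
(`IsVeluThreePair.T_add_T : T + T = −T`); a rational `3`-torsion point spans a `Γ_ℚ`-stable line
(`exists_isRationalLine_of_nsmul_eq_zero`), so `E_{B⁴}[3]` is reducible
(`not_hasIrreducibleModPGaloisRep_of_isRationalLine`). Reducibility passes to any `ℚ`-model of a
quadratic twist (`not_hasIrreducibleModPGaloisRep_twist`, Silverman *AEC* X.5.4: the twist
isomorphism is `Γ_ℚ`-equivariant up to sign), and `S` is a `ℚ`-model of `E_{B⁴}^{(B)}`
(`y² = x³ + B⁷ ≅ y² = x³ + B`, `u = B⁻¹`); finally irreducibility is invariant under the change of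
variables `S = C • W` (`Mazur1978.hasIrreducibleModPGaloisRep_smul_iff`). Classically: the
`3`-torsion points `(0, ±√B)` of `y² = x³ + B` form with `O` a `Γ_ℚ`-stable subgroup — every
`j = 0` curve admits a rational `3`-isogeny.

References: J. H. Silverman, *AEC* (2009) III.1 (short Weierstrass form), X.5.4 (twists)
[SilvermanAEC2009]; J. E. Cremona, *Algorithms* §3.8 (Vélu) [Cremona1997]; B. Mazur, Invent.
Math. 44 (1978) §5 [Mazur1978]; harvest-1 RECLASSIFY.md §GEN-15.
-/

set_option autoImplicit false

noncomputable section

open scoped Classical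

open WeierstrassCurve Literature.NumberTheory.EllipticCurves
  Literature.NumberTheory.EllipticCurves.Rank1Residual

namespace Summit.BirchSwinnertonDyer.Rank1Residual.X12

/-! ## §1 A rational `3`-torsion point: `E_{0,s} : y² = x³ + s²` is reducible at `3` -/

/-- **`y² = x³ + (mx + s)²` has reducible `E[3]`** (over `ℚ`, when non-singular): the rational point
`T = (0, s)` has order `3` (`T + T = −T`, tree `IsVeluThreePair.T_add_T`), so `ℤT ≤ E[3]` is a
`Γ_ℚ`-stable line. [cite: Cremona1997, §3.8 (Vélu's formulae for a rational 3-torsion point)] -/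
theorem not_irr_three_threeTorsionModel (m s : ℚ) (hΔ : (threeTorsionModel m s).Δ ≠ 0) :
    ¬ (threeTorsionModel m s).HasIrreducibleModPGaloisRep 3 := by
  haveI : (threeTorsionModel m s).IsElliptic := by
    rw [isElliptic_threeTorsionModel_iff, ← Δ_threeTorsionModel]
    exact hΔ
  have h := isVeluThreePair_threeTorsionModel hΔ
  have h3 : 3 • h.T = 0 := by
    rw [show (3 : ℕ) = 2 + 1 from rfl, add_nsmul, two_nsmul, one_nsmul, h.T_add_T, neg_add_cancel]
  obtain ⟨Φ, hΦ, -, -, -⟩ := exists_isRationalLine_of_nsmul_eq_zero (threeTorsionModel m s) h.T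
    h.T_ne_zero h3
  exact not_hasIrreducibleModPGaloisRep_of_isRationalLine hΦ

/-! ## §2 Every `j = 0` curve over `ℚ` is reducible at `3` -/

/-- A short Weierstrass model with `j = 0` has `a₄ = 0` (`j = 6912a₄³/(4a₄³ + 27a₆²)`).
[cite: SilvermanAEC2009, III.1 (c₄ = −48a₄ in short form)] -/
theorem a₄_eq_zero_of_isShortNF_of_j_eq_zero (S : WeierstrassCurve ℚ) [S.IsElliptic] [S.IsShortNF]
    (hj : S.j = 0) : S.a₄ = 0 := by
  have hden := four_mul_a₄_cube_add_ne_zero S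
  have h := S.j_of_isShortNF
  rw [hj, eq_comm, div_eq_zero_iff] at h
  rcases h with h | h
  · have : S.a₄ ^ 3 = 0 := by linarith
    exact pow_eq_zero_iff (n := 3) (by norm_num) |>.mp this
  · exact absurd h hden

/-- **A short model `y² = x³ + B` (`j = 0`) has reducible `E[3]`**: it is a `ℚ`-model of the
twist by `B` of `y² = x³ + B⁴ = threeTorsionModel 0 B²` (rational `3`-torsion `(0, B²)`), and
reducibility passes to models of twists (`not_hasIrreducibleModPGaloisRep_twist`, *AEC* X.5.4).
[cite: SilvermanAEC2009, X.5 Prop. 5.4 and III.1] [cite: Cremona1997, §3.8] -/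
theorem red_three_of_isShortNF_of_j_eq_zero (S : WeierstrassCurve ℚ) [S.IsElliptic] [S.IsShortNF]
    (hjS : S.j = 0) : ¬ S.HasIrreducibleModPGaloisRep 3 := by
  have hA : S.a₄ = 0 := a₄_eq_zero_of_isShortNF_of_j_eq_zero S hjS
  have hB : S.a₆ ≠ 0 := by
    intro h0
    have hden := four_mul_a₄_cube_add_ne_zero S
    rw [hA, h0] at hden
    norm_num at hden
  -- the twist `y² = x³ + B⁴ = threeTorsionModel 0 B²` is reducible at `3`
  have hΔ : (threeTorsionModel (0 : ℚ) (S.a₆ ^ 2)).Δ ≠ 0 := by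
    rw [Δ_threeTorsionModel]
    have : (16 : ℚ) * (S.a₆ ^ 2) ^ 3 * (4 * 0 ^ 3 - 27 * S.a₆ ^ 2) = -432 * S.a₆ ^ 8 := by ring
    rw [this]
    exact mul_ne_zero (by norm_num) (pow_ne_zero 8 hB)
  have hred := not_irr_three_threeTorsionModel (0 : ℚ) (S.a₆ ^ 2) hΔ
  haveI : (threeTorsionModel (0 : ℚ) (S.a₆ ^ 2)).IsElliptic := by
    rw [isElliptic_threeTorsionModel_iff, ← Δ_threeTorsionModel]
    exact hΔ
  -- `S` is a `ℚ`-model of the twist of `threeTorsionModel 0 B²` by `B`: `C₂ • S = y² = x³ + B⁷`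
  set C₂ : VariableChange ℚ := ⟨(Units.mk0 S.a₆ hB)⁻¹, 0, 0, 0⟩ with hC₂
  have hmodel : C₂ • S = (threeTorsionModel (0 : ℚ) (S.a₆ ^ 2)).quadraticTwist S.a₆ := by
    ext
    · rw [variableChange_a₁, quadraticTwist_a₁, S.a₁_of_isShortNF]
      simp [hC₂]
    · rw [variableChange_a₂, quadraticTwist_a₂, S.a₁_of_isShortNF, S.a₂_of_isShortNF]
      simp [hC₂, threeTorsionModel, WeierstrassCurve.b₂]
    · rw [variableChange_a₃, quadraticTwist_a₃, S.a₁_of_isShortNF, S.a₃_of_isShortNF]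
      simp [hC₂]
    · rw [variableChange_a₄, quadraticTwist_a₄, S.a₁_of_isShortNF, S.a₂_of_isShortNF,
        S.a₃_of_isShortNF, hA]
      simp [hC₂, threeTorsionModel, WeierstrassCurve.b₄]
    · rw [variableChange_a₆, quadraticTwist_a₆, S.a₁_of_isShortNF, S.a₂_of_isShortNF,
        S.a₃_of_isShortNF, hA]
      simp only [hC₂, inv_inv, Units.val_mk0, threeTorsionModel, WeierstrassCurve.b₆]
      ring
  exact not_hasIrreducibleModPGaloisRep_twist (W := threeTorsionModel (0 : ℚ) (S.a₆ ^ 2)) (p := 3)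
    hred hB S C₂ hmodel

/-- **`j(E) = 0 ⟹ E[3]` is reducible**, for EVERY elliptic curve `E/ℚ` (any Weierstrass model):
the `3`-torsion points `(0, ±√B)` of a short model `y² = x³ + B` span a `Γ_ℚ`-stable line — i.e.
every `j = 0` curve has a rational `3`-isogeny. Proof through the tree: short model `S = C • W`
with `a₄ = 0`; `S` is a `ℚ`-model of the twist by `B = a₆(S)` of `y² = x³ + B⁴ =
threeTorsionModel 0 B²`, which is reducible at `3` (§1); reducibility passes to models of twists
(`not_hasIrreducibleModPGaloisRep_twist`) and along `C` (`Mazur1978.hasIrreducibleModPGaloisRep_smul_iff`).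
[cite: SilvermanAEC2009, X.5 Prop. 5.4 and III.1] [cite: Cremona1997, §3.8] -/
theorem red_three_of_j_eq_zero (W : WeierstrassCurve ℚ) [W.IsElliptic] (hj : W.j = 0) :
    ¬ W.HasIrreducibleModPGaloisRep 3 := by
  obtain ⟨C, hC⟩ := W.exists_variableChange_isShortNF
  haveI := hC
  have hjS : (C • W).j = 0 := by rw [variableChange_j, hj]
  have hredS := red_three_of_isShortNF_of_j_eq_zero (C • W) hjS
  exact fun hW ↦ hredS ((Mazur1978.hasIrreducibleModPGaloisRep_smul_iff W C 3).mpr hW)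

/-! ## §3 Cell vocabulary: the dichotomy on the `j = 0` family -/

section Cell

variable (W : WeierstrassCurve ℚ) [W.IsElliptic]

/-- `j = 0 ⟹ red(3)` (cell predicate `Red`; any model). [cite: SilvermanAEC2009, X.5 Prop. 5.4 and III.1] -/
theorem red_three_of_j_eq_zero' (hj : W.j = 0) : Red W 3 :=
  red_three_of_j_eq_zero W hj

/-- `j = 0 ⟹ ¬ irr(3)`. [cite: SilvermanAEC2009, X.5 Prop. 5.4 and III.1] -/
theorem not_irr_three_of_j_eq_zero (hj : W.j = 0) : ¬ Irr W 3 :=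
  red_three_of_j_eq_zero W hj

/-- **Dichotomy on the `j = 0` family at odd `p`: `irr(p) ⟺ p ≠ 3`** (gen-14
`hasIrreducibleModPGaloisRep_of_j_eq_zero` for `p ≥ 5`, this file for `p = 3`).
[cite: Mazur1978, §6 Prop. 6.3 (1) (p. 153)] [cite: SilvermanAEC2009, X.5 Prop. 5.4 and III.1] -/
theorem irr_iff_ne_three_of_j_eq_zero (hj : W.j = 0) (p : ℕ) [hp : Fact p.Prime] (hp2 : p ≠ 2) :
    Irr W p ↔ p ≠ 3 := by
  constructor
  · rintro h rfl
    exact red_three_of_j_eq_zero W hj h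
  · intro h3
    have hp5 : 5 ≤ p := by
      have h2 := hp.out.two_le
      by_contra hlt
      push Not at hlt
      interval_cases p
      · exact absurd rfl hp2
      · exact absurd rfl h3
      · exact absurd hp.out (by decide)
    exact hasIrreducibleModPGaloisRep_of_j_eq_zero W hj p hp5

/-- **Dichotomy in CM-field terms on the `j = 0` family at odd `p`: `irr(p) ⟺ ¬ CMRamified`**
(`d_K = −3`, so `CMRamified W p ⟺ p = 3`). [cite: Mazur1978, §6 Prop. 6.3 (1) (p. 153)] [cite: SilvermanAEC2009, X.5 Prop. 5.4 and III.1] -/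
theorem irr_iff_not_cmRamified_of_j_eq_zero (hj : W.j = 0) (p : ℕ) [hp : Fact p.Prime]
    (hp2 : p ≠ 2) : Irr W p ↔ ¬ CMRamified W p := by
  have h3 : cmFieldDiscrOfJ W.j = -3 := by rw [hj]; norm_num [cmFieldDiscrOfJ]
  have hram : CMRamified W p ↔ p = 3 := by
    show (p : ℤ) ∣ cmFieldDiscrOfJ W.j ↔ p = 3
    rw [h3, dvd_neg, Int.natCast_dvd_ofNat]
    exact Nat.prime_dvd_prime_iff_eq hp.out Nat.prime_three
  rw [irr_iff_ne_three_of_j_eq_zero W hj p hp2, hram]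

end Cell

end Summit.BirchSwinnertonDyer.Rank1Residual.X12

end
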